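import Literature.Analysis.Fourier.ConvolutionOperatorGradient
import Literature.Analysis.Matrix.FiniteRangeDecompositionMomentum
import Literature.Analysis.Matrix.FiniteRangeDecomposition
import HarnessLib

/-!
# Finite-range decomposition: iterated differences — mixed differences, momentum bounds on the
# gradient factors, and the finite range of differences

Small companion of `ConvolutionOperatorGradient.lean` (`rowDiff`, `rowDiffs`),
`FiniteRangeDecompositionMomentum.lean` (`addCharMomentum`) and `FiniteRangeDecomposition.lean`
(`HasFiniteRange`), collecting the three elementary facts about iterated lattice differences that the
volume-uniform gradient bounds (`FiniteRangeDecompositionPowGradient.lean`) and their dipole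
corollaries use:

* `IsTranslationInvariant.mixedDiff_eq_rowDiffs` — for a translation-invariant kernel the mixed second
  difference (one forward difference in EACH variable) is an iterated row difference,
  `A(x+g,y+h) − A(x,y+h) − A(x+g,y) + A(x,y) = (∇_g∇_{−h}A)(x,y)`;
* `norm_addChar_sub_one_le_momentum`, `prod_norm_addChar_sub_one_le` — the gradient factors under
  the momentum sum are bounded by the momentum: `‖ψ(±e_i) − 1‖ = 2|sin(πt_i)| ≤ 2π|t_i| ≤ 2πu`
  whenever `|t_i| ≤ u` for all `i`, hence `Π_{g∈l}‖ψ(g) − 1‖ ≤ (2πu)^{|l|}` for steps among `±e_i`;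
* `HasFiniteRange.rowDiffs_apply_eq_zero` — **differences of a finite-range kernel have finite
  range**: if `A` has range `≤ R` for a "distance" `d` that grows by at most one under the steps of
  `l`, then `(∇_l A)(x,y) = 0` whenever `d(x,y) > R + |l|`.

All [folklore]; cf. [cite: Bauerschmidt2013, Thm. 1.2 (finite range and `∇^α` bounds of the pieces)].
-/

noncomputable section

open Finset Real

/-! ### Mixed second differences are iterated row differences -/

namespace Literature.Analysis.Fourier.IsTranslationInvariant

/-- For a translation-invariant kernel, the **mixed second difference** — one forward difference in each
variable — is an iterated row difference:
`A(x+g,y+h) − A(x,y+h) − A(x+g,y) + A(x,y) = (∇_g ∇_{−h} A)(x, y)`. [folklore] -/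
theorem mixedDiff_eq_rowDiffs {G : Type*} [AddCommGroup G] {A : Matrix G G ℝ} (hA : IsTranslationInvariant A)
    (g h x y : G) :
    A (x + g) (y + h) - A x (y + h) - A (x + g) y + A x y
      = _root_.Literature.Analysis.Fourier.rowDiffs [g, -h] A x y := by
  simp only [rowDiffs_cons, rowDiffs_nil, rowDiff_apply]
  have h1 : A (x + g) (y + h) = A (x + g + -h) y := by
    have := hA h (x + g + -h) y
    rwa [neg_add_cancel_right] at this
  have h2 : A x (y + h) = A (x + -h) y := by
    have := hA h (x + -h) y
    rwa [neg_add_cancel_right] at this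
  rw [h1, h2]
  ring

end Literature.Analysis.Fourier.IsTranslationInvariant

namespace Literature.Analysis.Matrix

open Literature.Analysis.Fourier Literature.Analysis.Fourier.TrigApprox

variable {G : Type*} [AddCommGroup G] [Fintype G]

/-! ### The gradient factors are bounded by the momentum -/

/-- `‖ψ(e) − 1‖ ≤ 2π|t|` for the momentum `t` of `ψ` along a step `e` of order dividing `L ≠ 0`
(`‖ψ(e) − 1‖ = 2|sin(πt)|` and Jordan). [folklore] -/
theorem norm_addChar_sub_one_le_momentum {L : ℕ} (hL : L ≠ 0) {g : G} (hg : L • g = 0) (ψ : AddChar G ℂ) :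
    ‖ψ g - 1‖ ≤ 2 * π * |addCharMomentum L g ψ| := by
  have hsq : ‖ψ g - 1‖ ^ 2 = (2 * |Real.sin (π * addCharMomentum L g ψ)|) ^ 2 := by
    rw [norm_addChar_sub_one_sq, two_sub_two_re_eq hL hg ψ, mul_pow, sq_abs]; norm_num
  have hle : 2 * |Real.sin (π * addCharMomentum L g ψ)| ≤ 2 * π * |addCharMomentum L g ψ| := by
    have h1 : |Real.sin (π * addCharMomentum L g ψ)| ≤ |π * addCharMomentum L g ψ| := Real.abs_sin_le_abs
    rw [abs_mul, abs_of_pos Real.pi_pos] at h1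
    linarith
  have h2 : ‖ψ g - 1‖ ^ 2 ≤ (2 * π * |addCharMomentum L g ψ|) ^ 2 := by
    rw [hsq]; exact pow_le_pow_left₀ (by positivity) hle 2
  exact (pow_le_pow_iff_left₀ (norm_nonneg _) (by positivity) two_ne_zero).mp h2

/-- **The gradient factors are bounded by the momentum**: if every step of `l` is one of `±e_i` and
`|t_i| ≤ u` for all `i`, then `Π_{g∈l} ‖ψ(g) − 1‖ ≤ (2πu)^{|l|}`. [folklore] -/
theorem prod_norm_addChar_sub_one_le
    (e : Fin 3 → G) (Ls : Fin 3 → ℕ) (hL : ∀ i, Ls i ≠ 0) (he : ∀ i, Ls i • e i = 0) (ψ : AddChar G ℂ)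
    {u : ℝ} (hu : ∀ i, |addCharMomentum (Ls i) (e i) ψ| ≤ u)
    (l : List G) (hl : ∀ g ∈ l, ∃ i, g = e i ∨ g = -e i) :
    (l.map fun g => ‖ψ g - 1‖).prod ≤ (2 * π * u) ^ l.length := by
  have hu0 : 0 ≤ u := (abs_nonneg _).trans (hu 0)
  induction l with
  | nil => simp
  | cons g l ih =>
    rw [List.map_cons, List.prod_cons, List.length_cons, pow_succ, mul_comm ((2 * π * u) ^ _)]
    have hg : ‖ψ g - 1‖ ≤ 2 * π * u := by
      obtain ⟨i, hi | hi⟩ := hl g (List.mem_cons_self)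
      · rw [hi]
        exact (norm_addChar_sub_one_le_momentum (hL i) (he i) ψ).trans (by gcongr; exact hu i)
      · rw [hi, norm_addChar_neg_sub_one]
        exact (norm_addChar_sub_one_le_momentum (hL i) (he i) ψ).trans (by gcongr; exact hu i)
    have hrest := ih fun g' hg' => hl g' (List.mem_cons_of_mem g hg')
    have hprod0 : 0 ≤ (l.map fun g => ‖ψ g - 1‖).prod :=
      List.prod_nonneg fun x hx => by
        obtain ⟨g', -, rfl⟩ := List.mem_map.mp hx
        exact norm_nonneg _
    exact mul_le_mul hg hrest hprod0 (by positivity)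

/-! ### Differences of a finite-range kernel have finite range -/

/-- **Differences of a finite-range kernel have finite range.**  If `A` has range `≤ R` for the
"distance" `d` and `d` grows by at most one under each step of `l` (`d(x,y) ≤ d(x+g,y) + 1`), then
`(∇_{g₁}⋯∇_{g_k} A)(x,y) = 0` whenever `d(x,y) > R + k`. [folklore] -/
theorem HasFiniteRange.rowDiffs_apply_eq_zero {V : Type*} [AddCommGroup V] {d : V → V → ℕ} {R : ℕ}
    {A : _root_.Matrix V V ℝ} (hA : HasFiniteRange d R A) (l : List V)
    (hstep : ∀ g ∈ l, ∀ x y : V, d x y ≤ d (x + g) y + 1) {x y : V} (hxy : R + l.length < d x y) :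
    rowDiffs l A x y = 0 := by
  induction l generalizing x with
  | nil => exact hA x y (by simpa using hxy)
  | cons g l ih =>
    rw [rowDiffs_cons, rowDiff_apply]
    have hl : ∀ g' ∈ l, ∀ x y : V, d x y ≤ d (x + g') y + 1 := fun g' hg' => hstep g' (List.mem_cons_of_mem g hg')
    have h1 : R + l.length < d (x + g) y := by
      have := hstep g (List.mem_cons_self) x y
      rw [List.length_cons] at hxy
      omega
    have h2 : R + l.length < d x y := by rw [List.length_cons] at hxy; omega
    rw [ih hl h1, ih hl h2, sub_zero]

/-- The mixed second difference of a finite-range translation-invariant kernel vanishes beyond the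
range plus two: `A(x+g,y+h) − A(x,y+h) − A(x+g,y) + A(x,y) = 0` if `d(x,y) > R + 2` and `d` grows by
at most one under the steps `g` and `−h`. [folklore] -/
theorem HasFiniteRange.mixedDiff_eq_zero {V : Type*} [AddCommGroup V] {d : V → V → ℕ} {R : ℕ}
    {A : _root_.Matrix V V ℝ} (hA : HasFiniteRange d R A) (hT : IsTranslationInvariant A) (g h : V)
    (hg : ∀ x y : V, d x y ≤ d (x + g) y + 1) (hh : ∀ x y : V, d x y ≤ d (x + -h) y + 1)
    {x y : V} (hxy : R + 2 < d x y) :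
    A (x + g) (y + h) - A x (y + h) - A (x + g) y + A x y = 0 := by
  rw [hT.mixedDiff_eq_rowDiffs g h x y]
  refine hA.rowDiffs_apply_eq_zero [g, -h] (fun g' hg' => ?_) (by simpa using hxy)
  simp only [List.mem_cons, List.not_mem_nil, or_false] at hg'
  rcases hg' with rfl | rfl
  · exact hg
  · exact hh

end Literature.Analysis.Matrix

end
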